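import Literature.Analysis.FluidPDE.DriftDiffusionMaxPrinciple
import HarnessLib

/-!
# ArgmaxDoorsSupNorm — door family S35 «ArgmaxDoors», plate E2 «SupNormComparison» in abstract form

Two weighted forms of the tree's Friedman weak maximum principle
(`Literature.Analysis.FluidPDE.norm_le_of_inner_timeDeriv_le`, `DriftDiffusionMaxPrinciple`) in which
the growth of `|W|²` is controlled ONLY AT (large) NON-ZERO GLOBAL SPATIAL MAXIMA of `|W(t,·)|` — the
"barrier / first-touch" step that turns a pointwise inequality at the argmax into a sup-norm bound.
NO PDE inside: the PDE enters through the user's argmax inequality (plate E1, `ArgmaxDoorsGrowth`).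

* `norm_le_mul_exp_of_argmax_inner_timeDeriv_le` — rate form: `⟪W,∂ₜW⟫ ≤ φ|W|²` at every non-zero
  global argmax, `φ = Φ'` ⇒ `sup|W(t)| ≤ sup|W(0)|·e^{Φ(t)−Φ(0)}`;
* `norm_le_supersolution_of_argmax_growth` — threshold form: `B > 0` with `B' ≥ φB`, the hypothesis
  only at argmaxima with `|W| > B(t)` ⇒ (`|W(0)| ≤ B(0)` → `|W(t)| ≤ B(t)`) — the engine of the phase
  lemma (door B: `B = ε/(T−t) + c(T−t)^{−a}`, `φ = a/(T−t)`).

HONEST FRAME / WHAT THIS IS NOT: tools for regularity CRITERIA about hypothetical blow-up (door family S35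
«ArgmaxDoors», nsreg-p1 g29 ROUND-33, S-door lane LEAD ns-s30-p1 g3, `--supports stmt-NavierStokesRegularity-0056 --as helper`);
item 0056 `NoTypeII` and NS regularity are NOT proved; no Literature fact is taken as a hypothesis; nothing here is a
route or a summit statement.
-/

noncomputable section

open Set Function Filter Metric MeasureTheory
open scoped RealInnerProductSpace Laplacian ContDiff Topology

set_option linter.dupNamespace false

namespace Summit.NavierStokesRegularity.NavierStokesRegularity.Theorems.ArgmaxDoors

open Literature.Analysis.FluidPDE

section Abstract

variable {E : Type*} [NormedAddCommGroup E] [InnerProductSpace ℝ E] [FiniteDimensional ℝ E]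
variable {F : Type*} [NormedAddCommGroup F] [InnerProductSpace ℝ F]

/-- **Sup-norm comparison from growth at the argmax** (weighted Friedman maximum principle; the
reaction is controlled only at non-zero global spatial maxima). Let `W : [0,T] × E → F` be jointly
`C^∞` on the closed slab with `|W(t,x)| → 0` as `|x| → ∞` uniformly in `t ∈ [0,T]`, let `Φ` be
continuous on `[0,T]` with one-sided derivative `φ(t)` within `[0,T]` at every `t`, and suppose that
for every `t ∈ (0,T]` and every point `x̄` with `|W(t,x)| ≤ |W(t,x̄)|` for all `x` and `W(t,x̄) ≠ 0`:
`⟪W(t,x̄), ∂ₜW(t,x̄)⟫ ≤ φ(t)|W(t,x̄)|²` (one-sided time derivative within `[0,T]`). Then every bound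
`M` of `|W(0,·)|` propagates with the integrating factor: `|W(t,x)| ≤ M e^{Φ(t) − Φ(0)}` on the slab.
Proof: for `ε > 0` the function `ψ = e^{−2Φ(t) − 2εt}|W|²` attains its maximum over the slab (uniform
decay + compactness); a maximum above `e^{−2Φ(0)}M²` sits at `(t₀,x₀)` with `t₀ > 0`, `x₀` a global
argmax of `|W(t₀,·)|`, `W(t₀,x₀) ≠ 0`; one-sided Fermat in `t` gives
`0 ≤ ∂ₜψ = e^{…}(−2(φ+ε)|W|² + 2⟪W,∂ₜW⟫) ≤ −2εe^{…}|W|² < 0`. [cite: Friedman1964, Ch. 2 §4 Lemma 5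
(the device); folklore] -/
theorem norm_le_mul_exp_of_argmax_inner_timeDeriv_le {T : ℝ} {W : ℝ → E → F}
    (hW : IsSmoothSpaceTimeOn (Icc 0 T) W)
    (hunif : ∀ η : ℝ, 0 < η → ∃ R : ℝ, ∀ t ∈ Icc 0 T, ∀ x : E, R ≤ ‖x‖ → ‖W t x‖ ≤ η)
    {Φ φ : ℝ → ℝ} (hΦc : ContinuousOn Φ (Icc 0 T))
    (hΦ : ∀ t ∈ Icc 0 T, HasDerivWithinAt Φ (φ t) (Icc 0 T) t)
    (hgrow : ∀ t ∈ Icc 0 T, 0 < t → ∀ x₀ : E, (∀ x, ‖W t x‖ ≤ ‖W t x₀‖) → W t x₀ ≠ 0 →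
      ⟪W t x₀, timeDerivWithin (Icc 0 T) W t x₀⟫ ≤ φ t * ‖W t x₀‖ ^ 2)
    {M : ℝ} (hM : ∀ x, ‖W 0 x‖ ≤ M) :
    ∀ t ∈ Icc 0 T, ∀ x, ‖W t x‖ ≤ M * Real.exp (Φ t - Φ 0) := by
  have hM0 : 0 ≤ M := (norm_nonneg _).trans (hM 0)
  -- a bound for `|Φ|` on the slab
  by_cases hT : T < 0
  · intro t ht; exact absurd (ht.1.trans ht.2) (not_le.2 hT)
  push Not at hT
  obtain ⟨CΦ, hCΦ⟩ := (isCompact_Icc (a := (0 : ℝ)) (b := T)).exists_bound_of_continuousOn hΦc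
  have hCΦ0 : 0 ≤ CΦ := (norm_nonneg _).trans (hCΦ 0 ⟨le_rfl, hT⟩)
  set B : ℝ := Real.exp (-(2 * Φ 0)) * M ^ 2 with hB
  have hB0 : 0 ≤ B := by positivity
  -- the weighted bound for every `ε > 0`
  suffices key : ∀ ε : ℝ, 0 < ε →
      ∀ t ∈ Icc 0 T, ∀ x, Real.exp (-(2 * Φ t + 2 * ε * t)) * ‖W t x‖ ^ 2 ≤ B by
    intro t ht x
    have hlim : Real.exp (-(2 * Φ t)) * ‖W t x‖ ^ 2 ≤ B := by
      have hc : Continuous fun ε : ℝ => Real.exp (-(2 * Φ t + 2 * ε * t)) * ‖W t x‖ ^ 2 := by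
        fun_prop
      have h0 : Tendsto (fun ε : ℝ => Real.exp (-(2 * Φ t + 2 * ε * t)) * ‖W t x‖ ^ 2) (𝓝[>] 0)
          (𝓝 (Real.exp (-(2 * Φ t)) * ‖W t x‖ ^ 2)) := by
        have := (hc.tendsto 0).mono_left (nhdsWithin_le_nhds (s := Ioi (0 : ℝ)))
        simpa using this
      exact le_of_tendsto h0 (eventually_nhdsWithin_of_forall fun ε hε => key ε hε t ht x)
    have hsq : ‖W t x‖ ^ 2 ≤ (M * Real.exp (Φ t - Φ 0)) ^ 2 := by
      have hE : 0 < Real.exp (-(2 * Φ t)) := Real.exp_pos _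
      have h1 : ‖W t x‖ ^ 2 ≤ B / Real.exp (-(2 * Φ t)) := by
        rw [le_div_iff₀ hE, mul_comm]; exact hlim
      have h2 : B / Real.exp (-(2 * Φ t)) = (M * Real.exp (Φ t - Φ 0)) ^ 2 := by
        rw [hB, mul_pow, ← Real.exp_nat_mul, div_eq_iff hE.ne', mul_comm (M ^ 2), mul_assoc,
          mul_comm (M ^ 2), ← mul_assoc, ← Real.exp_add]
        congr 1
        congr 1
        push_cast
        ring
      rwa [h2] at h1
    exact (pow_le_pow_iff_left₀ (norm_nonneg _) (by positivity) two_ne_zero).mp hsq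
  intro ε hε
  by_contra hcon
  push Not at hcon
  obtain ⟨t₁, ht₁, x₁, hlt⟩ := hcon
  -- the weight and its uniform bound on the slab
  set w : ℝ → ℝ := fun t => Real.exp (-(2 * Φ t + 2 * ε * t)) with hw
  have hwpos : ∀ t, 0 < w t := fun t => Real.exp_pos _
  have hwle : ∀ t ∈ Icc (0 : ℝ) T, w t ≤ Real.exp (2 * CΦ) := fun t ht => by
    rw [hw, Real.exp_le_exp]
    have h1 : |Φ t| ≤ CΦ := by simpa [Real.norm_eq_abs] using hCΦ t ht
    have h2 : -Φ t ≤ CΦ := (neg_le_abs _).trans h1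
    nlinarith [ht.1, hε]
  -- `S' > B ≥ 0` is a value of the weighted square; outside a large ball it is `< S'`, uniformly in `t`
  set S' : ℝ := w t₁ * ‖W t₁ x₁‖ ^ 2 with hS'
  have hS'pos : 0 < S' := hB0.trans_lt hlt
  set A : ℝ := Real.exp (2 * CΦ) with hA
  have hApos : 0 < A := Real.exp_pos _
  obtain ⟨R, hR⟩ := hunif (Real.sqrt (S' / A) / 2) (by positivity)
  have hout : ∀ t ∈ Icc 0 T, ∀ x : E, R ≤ ‖x‖ → w t * ‖W t x‖ ^ 2 < S' := by
    intro t ht x hx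
    have h2 : ‖W t x‖ ^ 2 ≤ (Real.sqrt (S' / A) / 2) ^ 2 :=
      pow_le_pow_left₀ (norm_nonneg _) (hR t ht x hx) 2
    have h3 : (Real.sqrt (S' / A) / 2) ^ 2 = S' / A / 4 := by
      rw [div_pow, Real.sq_sqrt (div_nonneg hS'pos.le hApos.le)]; norm_num
    have h4 : A * (S' / A / 4) = S' / 4 := by field_simp
    calc w t * ‖W t x‖ ^ 2 ≤ A * (S' / A / 4) := by
          rw [← h3]
          exact mul_le_mul (hwle t ht) h2 (sq_nonneg _) hApos.le
      _ = S' / 4 := h4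
      _ < S' := by linarith
  -- the maximum over the compact part `[0,T] × B̄_{R'}` is attained at some `(t₀, x₀)`
  set R' : ℝ := max R ‖x₁‖ with hR'
  set K : Set (ℝ × E) := Icc 0 T ×ˢ Metric.closedBall (0 : E) R' with hK
  have hKc : IsCompact K := isCompact_Icc.prod (isCompact_closedBall _ _)
  have h1K : (t₁, x₁) ∈ K := mk_mem_prod ht₁ (by simp [hR'])
  set ψ : ℝ × E → ℝ := fun z => w z.1 * ‖W z.1 z.2‖ ^ 2 with hψ
  have hψc : ContinuousOn ψ K := by
    have hvc : ContinuousOn (uncurry W) K :=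
      hW.continuousOn.mono (prod_mono le_rfl (subset_univ _))
    have hec : ContinuousOn (fun z : ℝ × E => w z.1) K := by
      have hΦK : ContinuousOn (fun z : ℝ × E => Φ z.1) K :=
        hΦc.comp continuous_fst.continuousOn fun z hz => (mem_prod.mp hz).1
      have hlin : Continuous fun z : ℝ × E => 2 * ε * z.1 := by fun_prop
      exact ((hΦK.const_smul (2 : ℝ)).add hlin.continuousOn).neg.rexp.congr fun z _ => by
        simp [hw, smul_eq_mul]
    exact hec.mul (hvc.norm.pow 2)
  obtain ⟨⟨t₀, x₀⟩, h0K, hmaxK⟩ := hKc.exists_isMaxOn ⟨(t₁, x₁), h1K⟩ hψc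
  have ht₀ : t₀ ∈ Icc 0 T := (mem_prod.mp h0K).1
  have hS'le : S' ≤ w t₀ * ‖W t₀ x₀‖ ^ 2 := isMaxOn_iff.mp hmaxK (t₁, x₁) h1K
  -- `(t₀, x₀)` is a maximum point over the whole slab
  have hglob : ∀ t ∈ Icc 0 T, ∀ x : E, w t * ‖W t x‖ ^ 2 ≤ w t₀ * ‖W t₀ x₀‖ ^ 2 := by
    intro t ht x
    by_cases hx : ‖x‖ ≤ R'
    · exact isMaxOn_iff.mp hmaxK (t, x) (mk_mem_prod ht (by simpa using hx))
    · have hRx : R ≤ ‖x‖ := (le_max_left _ _).trans (not_le.mp hx).le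
      exact ((hout t ht x hRx).trans_le hS'le).le
  -- `t₀ > 0`, since at `t = 0` the weighted square is `≤ B < S'`
  have ht₀pos : 0 < t₀ := by
    rcases ht₀.1.eq_or_lt with h | h
    · exfalso
      have h1 : w t₀ * ‖W t₀ x₀‖ ^ 2 ≤ B := by
        rw [← h, hw, hB]
        simp only [mul_zero, add_zero]
        exact mul_le_mul_of_nonneg_left (pow_le_pow_left₀ (norm_nonneg _) (hM x₀) 2)
          (Real.exp_pos _).le
      linarith
    · exact h
  -- the slice at `t₀`: `x₀` is a global argmax with `W ≠ 0`
  have hEpos : 0 < w t₀ := hwpos t₀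
  have hxmax : ∀ x, ‖W t₀ x‖ ≤ ‖W t₀ x₀‖ := fun x =>
    (pow_le_pow_iff_left₀ (norm_nonneg _) (norm_nonneg _) two_ne_zero).mp
      (le_of_mul_le_mul_left (hglob t₀ ht₀ x) hEpos)
  have hV0pos : 0 < ‖W t₀ x₀‖ ^ 2 := by
    by_contra h
    have h' : ‖W t₀ x₀‖ ^ 2 = 0 := le_antisymm (not_lt.mp h) (sq_nonneg _)
    rw [h', mul_zero] at hS'le
    linarith
  have hne : W t₀ x₀ ≠ 0 := by
    intro h0
    rw [h0, norm_zero] at hV0pos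
    simp at hV0pos
  -- the growth hypothesis at `(t₀, x₀)`
  have hinner : ⟪W t₀ x₀, timeDerivWithin (Icc 0 T) W t₀ x₀⟫ ≤ φ t₀ * ‖W t₀ x₀‖ ^ 2 :=
    hgrow t₀ ht₀ ht₀pos x₀ hxmax hne
  -- the time condition: `k(s) = w(s)|W(s,x₀)|²` is maximal over `[0,T]` at `t₀ > 0`
  have hγ : HasDerivWithinAt (fun s => W s x₀) (timeDerivWithin (Icc 0 T) W t₀ x₀) (Icc 0 T) t₀ := by
    rw [timeDerivWithin_apply]
    exact (hW.differentiableWithinAt_time ht₀ x₀).hasDerivWithinAt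
  have hf : HasDerivWithinAt (fun s : ℝ => -(2 * Φ s + 2 * ε * s)) (-(2 * φ t₀ + 2 * ε))
      (Icc 0 T) t₀ := by
    have h1 : HasDerivWithinAt (fun s : ℝ => 2 * ε * s) (2 * ε) (Icc 0 T) t₀ := by
      have h := ((hasDerivAt_id t₀).const_mul (2 * ε)).hasDerivWithinAt (s := Icc 0 T)
      simpa using h
    exact (((hΦ t₀ ht₀).const_mul 2).add h1).neg
  have hk : HasDerivWithinAt (fun s => w s * ‖W s x₀‖ ^ 2)
      (w t₀ * (-(2 * φ t₀ + 2 * ε)) * ‖W t₀ x₀‖ ^ 2 +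
        w t₀ * (2 * ⟪W t₀ x₀, timeDerivWithin (Icc 0 T) W t₀ x₀⟫)) (Icc 0 T) t₀ :=
    hf.exp.mul hγ.norm_sq
  have htime := derivWithin_Icc_nonneg_of_forall_le ht₀ ht₀pos hk (fun s hs => hglob s hs x₀)
  -- contradiction
  have h1 : 0 < w t₀ * ε * ‖W t₀ x₀‖ ^ 2 := by positivity
  have h2 : w t₀ * ⟪W t₀ x₀, timeDerivWithin (Icc 0 T) W t₀ x₀⟫ ≤ w t₀ * (φ t₀ * ‖W t₀ x₀‖ ^ 2) :=
    mul_le_mul_of_nonneg_left hinner hEpos.le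
  nlinarith


/-- **Sup-norm comparison with a supersolution, growth controlled only at large argmaxima**
(threshold form of the weighted Friedman principle; the real-analysis heart of the phase lemma).
Let `W : [0,T] × E → F` be jointly `C^∞` on the closed slab with `|W(t,x)| → 0` as `|x| → ∞`
uniformly in `t`; let `B > 0` be continuous on `[0,T]` with one-sided derivative `B'` within `[0,T]`
and `φ(t)B(t) ≤ B'(t)` (a supersolution of `y' = φy`). Suppose that at every `t ∈ (0,T]` and every
global maximum point `x̄` of `|W(t,·)|` AT WHICH `|W(t,x̄)| > B(t)`:
`⟪W(t,x̄), ∂ₜW(t,x̄)⟫ ≤ φ(t)|W(t,x̄)|²`. If `|W(0,·)| ≤ B(0)` then `|W(t,x)| ≤ B(t)` on the slab.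
Proof: for `ε > 0`, `ψ = e^{−2εt}|W|²/B²` attains its maximum over the slab; a maximum value `> 1`
sits at `(t₀,x₀)` with `t₀ > 0`, `x₀` a global argmax with `|W| > B(t₀)`; one-sided Fermat in `t`
against `B' ≥ φB` and the hypothesis gives `0 ≤ ∂ₜψ < 0`. [cite: Friedman1964, Ch. 2 §4 Lemma 5
(the device); folklore] -/
theorem norm_le_supersolution_of_argmax_growth {T : ℝ} {W : ℝ → E → F}
    (hW : IsSmoothSpaceTimeOn (Icc 0 T) W)
    (hunif : ∀ η : ℝ, 0 < η → ∃ R : ℝ, ∀ t ∈ Icc 0 T, ∀ x : E, R ≤ ‖x‖ → ‖W t x‖ ≤ η)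
    {B B' φ : ℝ → ℝ} (hBc : ContinuousOn B (Icc 0 T)) (hBpos : ∀ t ∈ Icc 0 T, 0 < B t)
    (hBd : ∀ t ∈ Icc 0 T, HasDerivWithinAt B (B' t) (Icc 0 T) t)
    (hsuper : ∀ t ∈ Icc 0 T, φ t * B t ≤ B' t)
    (hgrow : ∀ t ∈ Icc 0 T, 0 < t → ∀ x₀ : E, (∀ x, ‖W t x‖ ≤ ‖W t x₀‖) → B t < ‖W t x₀‖ →
      ⟪W t x₀, timeDerivWithin (Icc 0 T) W t x₀⟫ ≤ φ t * ‖W t x₀‖ ^ 2)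
    (hM : ∀ x, ‖W 0 x‖ ≤ B 0) :
    ∀ t ∈ Icc 0 T, ∀ x, ‖W t x‖ ≤ B t := by
  by_cases hT : T < 0
  · intro t ht; exact absurd (ht.1.trans ht.2) (not_le.2 hT)
  push Not at hT
  have h0T : (0 : ℝ) ∈ Icc 0 T := ⟨le_rfl, hT⟩
  -- a positive lower bound for `B` on the slab
  obtain ⟨tm, htm, hmin⟩ := (isCompact_Icc (a := (0 : ℝ)) (b := T)).exists_isMinOn ⟨0, h0T⟩ hBc
  set b : ℝ := B tm with hb
  have hbpos : 0 < b := hBpos tm htm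
  have hBge : ∀ t ∈ Icc 0 T, b ≤ B t := fun t ht => isMinOn_iff.mp hmin t ht
  -- the weighted bound for every `ε > 0`
  suffices key : ∀ ε : ℝ, 0 < ε →
      ∀ t ∈ Icc 0 T, ∀ x, Real.exp (-(2 * ε * t)) * ‖W t x‖ ^ 2 / B t ^ 2 ≤ 1 by
    intro t ht x
    have hBt : 0 < B t := hBpos t ht
    have hlim : ‖W t x‖ ^ 2 / B t ^ 2 ≤ 1 := by
      have hc : Continuous fun ε : ℝ => Real.exp (-(2 * ε * t)) * ‖W t x‖ ^ 2 / B t ^ 2 := by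
        fun_prop
      have h0 : Tendsto (fun ε : ℝ => Real.exp (-(2 * ε * t)) * ‖W t x‖ ^ 2 / B t ^ 2) (𝓝[>] 0)
          (𝓝 (‖W t x‖ ^ 2 / B t ^ 2)) := by
        have := (hc.tendsto 0).mono_left (nhdsWithin_le_nhds (s := Ioi (0 : ℝ)))
        simpa using this
      exact le_of_tendsto h0 (eventually_nhdsWithin_of_forall fun ε hε => key ε hε t ht x)
    have hsq : ‖W t x‖ ^ 2 ≤ B t ^ 2 := by rwa [div_le_one (by positivity)] at hlim
    exact (pow_le_pow_iff_left₀ (norm_nonneg _) hBt.le two_ne_zero).mp hsq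
  intro ε hε
  by_contra hcon
  push Not at hcon
  obtain ⟨t₁, ht₁, x₁, hlt⟩ := hcon
  set w : ℝ → ℝ := fun t => Real.exp (-(2 * ε * t)) with hw
  have hwpos : ∀ t, 0 < w t := fun t => Real.exp_pos _
  have hwle : ∀ t ∈ Icc (0 : ℝ) T, w t ≤ 1 := fun t ht => by
    rw [hw, Real.exp_le_one_iff]; nlinarith [ht.1, hε]
  set ψ : ℝ × E → ℝ := fun z => w z.1 * ‖W z.1 z.2‖ ^ 2 / B z.1 ^ 2 with hψ
  -- `S' > 1` is a value of `ψ`; outside a large ball `ψ < S'` uniformly in `t`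
  set S' : ℝ := w t₁ * ‖W t₁ x₁‖ ^ 2 / B t₁ ^ 2 with hS'
  have hS'pos : 0 < S' := zero_lt_one.trans hlt
  obtain ⟨R, hR⟩ := hunif (b * Real.sqrt S' / 2) (by positivity)
  have hout : ∀ t ∈ Icc 0 T, ∀ x : E, R ≤ ‖x‖ → w t * ‖W t x‖ ^ 2 / B t ^ 2 < S' := by
    intro t ht x hx
    have hBt : 0 < B t := hBpos t ht
    have h2 : ‖W t x‖ ^ 2 ≤ (b * Real.sqrt S' / 2) ^ 2 :=
      pow_le_pow_left₀ (norm_nonneg _) (hR t ht x hx) 2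
    have h3 : (b * Real.sqrt S' / 2) ^ 2 = b ^ 2 * S' / 4 := by
      rw [div_pow, mul_pow, Real.sq_sqrt hS'pos.le]; ring
    have h4 : b ^ 2 ≤ B t ^ 2 := pow_le_pow_left₀ hbpos.le (hBge t ht) 2
    calc w t * ‖W t x‖ ^ 2 / B t ^ 2 ≤ 1 * (b ^ 2 * S' / 4) / B t ^ 2 := by
          rw [← h3]; gcongr; exact hwle t ht
      _ ≤ 1 * (B t ^ 2 * S' / 4) / B t ^ 2 := by gcongr
      _ = S' / 4 := by field_simp
      _ < S' := by linarith
  -- the maximum over the compact part is attained at some `(t₀, x₀)`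
  set R' : ℝ := max R ‖x₁‖ with hR'
  set K : Set (ℝ × E) := Icc 0 T ×ˢ Metric.closedBall (0 : E) R' with hK
  have hKc : IsCompact K := isCompact_Icc.prod (isCompact_closedBall _ _)
  have h1K : (t₁, x₁) ∈ K := mk_mem_prod ht₁ (by simp [hR'])
  have hψc : ContinuousOn ψ K := by
    have hvc : ContinuousOn (uncurry W) K :=
      hW.continuousOn.mono (prod_mono le_rfl (subset_univ _))
    have hec : Continuous fun z : ℝ × E => w z.1 := by fun_prop
    have hBK : ContinuousOn (fun z : ℝ × E => B z.1 ^ 2) K :=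
      (hBc.comp continuous_fst.continuousOn fun z hz => (mem_prod.mp hz).1).pow 2
    refine (hec.continuousOn.mul (hvc.norm.pow 2)).div hBK fun z hz => ?_
    exact pow_ne_zero 2 (hBpos z.1 (mem_prod.mp hz).1).ne'
  obtain ⟨⟨t₀, x₀⟩, h0K, hmaxK⟩ := hKc.exists_isMaxOn ⟨(t₁, x₁), h1K⟩ hψc
  have ht₀ : t₀ ∈ Icc 0 T := (mem_prod.mp h0K).1
  have hB₀ : 0 < B t₀ := hBpos t₀ ht₀
  have hS'le : S' ≤ w t₀ * ‖W t₀ x₀‖ ^ 2 / B t₀ ^ 2 := isMaxOn_iff.mp hmaxK (t₁, x₁) h1K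
  -- `(t₀, x₀)` is a maximum point over the whole slab
  have hglob : ∀ t ∈ Icc 0 T, ∀ x : E,
      w t * ‖W t x‖ ^ 2 / B t ^ 2 ≤ w t₀ * ‖W t₀ x₀‖ ^ 2 / B t₀ ^ 2 := by
    intro t ht x
    by_cases hx : ‖x‖ ≤ R'
    · exact isMaxOn_iff.mp hmaxK (t, x) (mk_mem_prod ht (by simpa using hx))
    · have hRx : R ≤ ‖x‖ := (le_max_left _ _).trans (not_le.mp hx).le
      exact ((hout t ht x hRx).trans_le hS'le).le
  -- `t₀ > 0`, since at `t = 0` the value is `≤ 1 < S'`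
  have ht₀pos : 0 < t₀ := by
    rcases ht₀.1.eq_or_lt with h | h
    · exfalso
      have hB00 : 0 < B 0 := hBpos 0 h0T
      have h1 : w t₀ * ‖W t₀ x₀‖ ^ 2 / B t₀ ^ 2 ≤ 1 := by
        rw [← h, hw]
        simp only [mul_zero, neg_zero, Real.exp_zero, one_mul]
        rw [div_le_one (by positivity)]
        exact pow_le_pow_left₀ (norm_nonneg _) (hM x₀) 2
      linarith
    · exact h
  -- the slice at `t₀`: `x₀` is a global argmax with `|W| > B(t₀)`
  have hE : 0 < w t₀ / B t₀ ^ 2 := by positivity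
  have hxmax : ∀ x, ‖W t₀ x‖ ≤ ‖W t₀ x₀‖ := fun x => by
    have h := hglob t₀ ht₀ x
    have h' : w t₀ / B t₀ ^ 2 * ‖W t₀ x‖ ^ 2 ≤ w t₀ / B t₀ ^ 2 * ‖W t₀ x₀‖ ^ 2 := by
      rw [div_mul_eq_mul_div, div_mul_eq_mul_div]; exact h
    exact (pow_le_pow_iff_left₀ (norm_nonneg _) (norm_nonneg _) two_ne_zero).mp
      (le_of_mul_le_mul_left h' hE)
  have hbig : B t₀ < ‖W t₀ x₀‖ := by
    have h1 : 1 < w t₀ * ‖W t₀ x₀‖ ^ 2 / B t₀ ^ 2 := hlt.trans_le hS'le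
    have h2 : B t₀ ^ 2 < w t₀ * ‖W t₀ x₀‖ ^ 2 := by rwa [lt_div_iff₀ (by positivity), one_mul] at h1
    have h3 : w t₀ * ‖W t₀ x₀‖ ^ 2 ≤ 1 * ‖W t₀ x₀‖ ^ 2 :=
      mul_le_mul_of_nonneg_right (hwle t₀ ht₀) (sq_nonneg _)
    have h4 : B t₀ ^ 2 < ‖W t₀ x₀‖ ^ 2 := by linarith
    exact (pow_lt_pow_iff_left₀ hB₀.le (norm_nonneg _) two_ne_zero).mp h4
  -- the growth hypothesis at `(t₀, x₀)`
  have hinner : ⟪W t₀ x₀, timeDerivWithin (Icc 0 T) W t₀ x₀⟫ ≤ φ t₀ * ‖W t₀ x₀‖ ^ 2 :=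
    hgrow t₀ ht₀ ht₀pos x₀ hxmax hbig
  -- the time condition: `k(s) = w(s)|W(s,x₀)|²/B(s)²` is maximal over `[0,T]` at `t₀ > 0`
  have hγ : HasDerivWithinAt (fun s => W s x₀) (timeDerivWithin (Icc 0 T) W t₀ x₀) (Icc 0 T) t₀ := by
    rw [timeDerivWithin_apply]
    exact (hW.differentiableWithinAt_time ht₀ x₀).hasDerivWithinAt
  have hf : HasDerivWithinAt (fun s : ℝ => -(2 * ε * s)) (-(2 * ε)) (Icc 0 T) t₀ := by
    have h := ((hasDerivAt_id t₀).const_mul (2 * ε)).hasDerivWithinAt (s := Icc 0 T)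
    simp only [id, mul_one] at h
    exact h.neg
  have hnum : HasDerivWithinAt (fun s => w s * ‖W s x₀‖ ^ 2)
      (w t₀ * (-(2 * ε)) * ‖W t₀ x₀‖ ^ 2 +
        w t₀ * (2 * ⟪W t₀ x₀, timeDerivWithin (Icc 0 T) W t₀ x₀⟫)) (Icc 0 T) t₀ :=
    hf.exp.mul hγ.norm_sq
  have hden : HasDerivWithinAt (fun s => B s ^ 2) (2 * B t₀ * B' t₀) (Icc 0 T) t₀ := by
    have h : HasDerivWithinAt (fun s => B s * B s) (B' t₀ * B t₀ + B t₀ * B' t₀) (Icc 0 T) t₀ :=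
      (hBd t₀ ht₀).mul (hBd t₀ ht₀)
    refine (h.congr_of_eventuallyEq (Eventually.of_forall fun s => ?_) ?_).congr_deriv ?_
    · exact sq (B s)
    · exact sq (B t₀)
    · ring
  have hk := hnum.div hden (pow_ne_zero 2 hB₀.ne')
  have htime := derivWithin_Icc_nonneg_of_forall_le ht₀ ht₀pos hk (fun s hs => hglob s hs x₀)
  -- the numerator of `k'` is negative: contradiction
  set V : ℝ := ‖W t₀ x₀‖ ^ 2 with hV
  set I : ℝ := ⟪W t₀ x₀, timeDerivWithin (Icc 0 T) W t₀ x₀⟫ with hI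
  have hVpos : 0 < V := by rw [hV]; exact pow_pos (hB₀.trans hbig) 2
  have hsup : φ t₀ * B t₀ ≤ B' t₀ := hsuper t₀ ht₀
  have hnumneg : (w t₀ * (-(2 * ε)) * V + w t₀ * (2 * I)) * B t₀ ^ 2 -
      w t₀ * V * (2 * B t₀ * B' t₀) < 0 := by
    have hw0 := hwpos t₀
    -- `= 2 w B [ (−εV + I) B − V B' ]` and `I ≤ φ V`, `V B' ≥ φ V B`
    have h1 : I * B t₀ ≤ φ t₀ * V * B t₀ := by
      have := mul_le_mul_of_nonneg_right hinner hB₀.le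
      rw [hI, hV]; linarith
    have h2 : φ t₀ * V * B t₀ ≤ V * B' t₀ := by
      have := mul_le_mul_of_nonneg_left hsup hVpos.le
      linarith
    have h3 : 0 < w t₀ * ε * V * B t₀ ^ 2 := by positivity
    nlinarith [h1, h2, h3, hw0, hB₀, mul_le_mul_of_nonneg_left (h1.trans h2) (mul_nonneg hw0.le hB₀.le)]
  have hderiv_neg : ((w t₀ * (-(2 * ε)) * V + w t₀ * (2 * I)) * B t₀ ^ 2 -
      w t₀ * V * (2 * B t₀ * B' t₀)) / (B t₀ ^ 2) ^ 2 < 0 :=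
    div_neg_of_neg_of_pos hnumneg (by positivity)
  exact absurd htime (not_le.2 hderiv_neg)


end Abstract

end Summit.NavierStokesRegularity.NavierStokesRegularity.Theorems.ArgmaxDoors

end
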